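/-
Copyright: literature formalisation for the harness. Statements follow the cited text.
-/
import Literature.AlgebraicGeometry.CossartPiltant200819.TotalRamification2008
import HarnessLib

/-!
# Cossart–Piltant I (2008), Thm 7.2 — the tame layers are totally ramified; Thm 7.2 from its leaves

Sequel to `TotalRamification2008`; DISCHARGES the named residual `TameLayersTotallyRamified2008`
of `TameSegment2008` — the layers of the tame tower `K₀ⁱ ⊂ ⋯ ⊂ K₀ʳ` are totally ramified: proof
of Thm 7.2, HAL p. 20, "By (8), `K₀ʳ/K₀ⁱ` is an Abelian extension of order prime to `p`, whence a
tower of Abelian extensions of prime degrees `lᵢ ≠ p` … by proposition 8.3 (2) (whose assumption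
is satisfied by (9))", assumption (2) of Prop. 8.3 being "`[L : K] = |WL/VK|`" (HAL p. 23) and
(8)–(9) the isomorphism `Gi/Gr ≃ Hom(WjL/VK, κ(Wj)^×)` and `[L : K] = sefp^d` of HAL p. 6
("[47] theorems 24 and 25" = Zariski–Samuel VI §12); Cossart–Piltant 2019, proof of Prop. 4.10:
"`Fʳ|Fⁱ` is an Abelian extension of order prime to `p` which is totally ramified". PROVED here:

* `inertiaGroup_eq_top_of_fixedField_le` — over any field `B₁ ⊇ Kⁱ` between `Kⁱ` and `L`, the
  inertia group of `W` is all of `Gal(L/B₁)`; `le_fixedField_ramificationGroup_of_le` — a field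
  below `Kʳ` (ramification field over `Kⁱ`) is below the ramification field over `B₁` (Lemma 6.1,
  HAL p. 17: "`Gi(S/R′) = Gi(S/R) ∩ Gal(L/K′)` … `Gr(S/R′) = Gr(S/R) ∩ Gal(L/K′)`");
* `TameLayersTotallyRamified2008_holds` — **the residual**: every layer `Kⁱ ⊆ B₁ ⊆ B ⊆ Kʳ` has
  `e(W ∩ B | W ∩ B₁) = [B : B₁]` (`ramificationIndex_eq_finrank_of_le_fixedField` over `B₁`);
* the now unconditional tower facts `tameSegmentClimb2008`, `coarseTowerExists2008`,
  `galoisTowerExists2008`, `towerExists2008`, and **Theorem 7.2 from exactly its three printed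
  leaves** `reductionToArtinSchreier_of_leaves : ClimbToInertiaField → PrimeDegreeAscent →
  DescentBelowRamificationField → ReductionToArtinSchreier` (Cor 6.3, Prop 8.3, Prop 9.5), and
  `lu3DiffFinite_of_leaves` (adding Prop 5.1 and [CP-II]).

## Sources

* V. Cossart, O. Piltant, J. Algebra 320 (2008), §3.2 (7)–(9) (HAL p. 6), Lemma 6.1 (HAL p. 17),
  Thm 7.2 and its proof (HAL pp. 19–21), Prop. 8.3 (HAL p. 23). [CossartPiltant2008]
* O. Zariski, P. Samuel, *Commutative Algebra* II (1960), Ch. VI §12 (pp. 67–82), Thm. 25.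
  [ZariskiSamuel1960]
* V. Cossart, O. Piltant, J. Algebra 529 (2019), proof of Prop. 4.10. [CossartPiltant2019]
-/

namespace Literature.AlgebraicGeometry.CossartPiltant200819.CP2008

open Literature.AlgebraicGeometry.Resolution IsLocalRing IntermediateField
open scoped Pointwise IntermediateField

universe u

section BaseChange

variable {K L : Type u} [Field K] [Field L] [Algebra K L] (W : ValuationSubring L)

/-- **Above `Kⁱ` the inertia group is everything**: for `Kⁱ = L^{G_i} ⊆ B₁ ⊆ L`, every
`B₁`-automorphism of `L` lies in the inertia group of `W` over `W ∩ B₁` (it restricts to an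
element of `Gal(L/Kⁱ) = G_i`, and the defining conditions do not see the base).
[cite: CossartPiltant2008, Section 3.1 (3) (HAL p. 5) and Lemma 6.1 (1) (HAL p. 17)] -/
theorem inertiaGroup_eq_top_of_fixedField_le [FiniteDimensional K L]
    (B₁ : IntermediateField (fixedField (inertiaGroup (K := K) W)) L) (σ : L ≃ₐ[B₁] L) :
    σ ∈ inertiaGroup (K := B₁) W := by
  have hGT : (fixedField (inertiaGroup (K := K) W)).fixingSubgroup = inertiaGroup (K := K) W :=
    fixingSubgroup_fixedField _
  have hρ : (σ.restrictScalars (fixedField (inertiaGroup (K := K) W))).restrictScalars K ∈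
      (fixedField (inertiaGroup (K := K) W)).fixingSubgroup := by
    rw [IntermediateField.mem_fixingSubgroup_iff]
    intro x hx
    exact (σ.restrictScalars (fixedField (inertiaGroup (K := K) W))).commutes ⟨x, hx⟩
  rw [hGT] at hρ
  obtain ⟨hW, hv⟩ := (mem_inertiaGroup_iff' W _).mp hρ
  refine (mem_inertiaGroup_iff' W σ).mpr ⟨?_, fun x hx => hv x hx⟩
  exact smul_eq_of_restrictScalars_smul_eq B₁ W σ
    (smul_eq_of_restrictScalars_smul_eq (fixedField (inertiaGroup (K := K) W)) W _ hW)

/-- **`Kʳ` over `Kⁱ` lies below the ramification field over `B₁`**: for `Kⁱ ⊆ B₁ ⊆ B ⊆ Kʳ`,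
`B` (as an intermediate field of `L/B₁`) is fixed by the ramification group of `W` in
`Gal(L/B₁)` (whose elements restrict to `G_r ≤ Gal(L/Kⁱ)`; Lemma 6.1-style base change).
[cite: CossartPiltant2008, Lemma 6.1 (2) (HAL p. 17)] -/
theorem le_fixedField_ramificationGroup_of_le
    (B₁ B : IntermediateField (fixedField (inertiaGroup (K := K) W)) L) (h : B₁ ≤ B)
    (hB : B ≤ fixedField
      (ramificationGroup (K := fixedField (inertiaGroup (K := K) W)) W)) :
    extendScalars h ≤ fixedField (ramificationGroup (K := B₁) W) := by
  intro x hx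
  rw [IntermediateField.mem_fixedField_iff]
  intro σ hσ
  have hσ' : σ.restrictScalars (fixedField (inertiaGroup (K := K) W)) ∈
      ramificationGroup (K := fixedField (inertiaGroup (K := K) W)) W :=
    (mem_ramificationGroup_iff W _).mpr ((mem_ramificationGroup_iff W σ).mp hσ)
  exact (IntermediateField.mem_fixedField_iff _ x).mp (hB hx) _ hσ'

end BaseChange

/-! ### The residual, discharged -/

/-- **The layers of `Kʳ/Kⁱ` are totally ramified** — DISCHARGE of the named residual
`TameLayersTotallyRamified2008` of `TameSegment2008`: for `L/K` finite Galois, `W` a valuation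
ring of `L` and `Kⁱ ⊆ B₁ ⊆ B ⊆ Kʳ`, `e(W ∩ B | W ∩ B₁) = [B : B₁]` (Zariski–Samuel VI §12
Thm 25 over the base `B₁`, whose inertia group is all of `Gal(L/B₁)`; the "assumption … satisfied
by (9)" of the proof of Thm 7.2, HAL p. 20).
[cite: CossartPiltant2008, Thm 7.2 proof (HAL p. 20) with §3.2 (8)–(9) (HAL p. 6);
ZariskiSamuel1960 VI §12 Thm 25] -/
theorem TameLayersTotallyRamified2008_holds : TameLayersTotallyRamified2008.{u} := by
  intro K L _ _ _ _ _ W B₁ B h hB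
  exact ramificationIndex_eq_finrank_of_le_fixedField W
    (inertiaGroup_eq_top_of_fixedField_le W B₁) (extendScalars h)
    (le_fixedField_ramificationGroup_of_le W B₁ B h hB)

variable {k : Type u} [Field k]

/-- **The tame climb `(Kⁱ, ·) → (Kʳ, ·)`** ("By (8) … by proposition 8.3 (2)", HAL p. 20) — now
unconditional. [cite: CossartPiltant2008, Thm 7.2 proof (HAL p. 20)] -/
theorem tameSegmentClimb2008 (k : Type u) [Field k] : TameSegmentClimb2008 k :=
  tameSegmentClimb2008_of_layers TameLayersTotallyRamified2008_holds k

/-- `TameSegmentClimb2008` holds for all parameters — `_holds` alias of `tameSegmentClimb2008` above under the fact's exact name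
(appended 2026-08-28, D-0026 bookkeeping: the proof term is the existing theorem of this file; no statement,
definition or attribute is edited; no new named fact; the ledger's debt table listed the fact
unproved). [cite: CossartPiltant2008, Thm 7.2 proof (HAL p. 20)] -/
theorem _root_.Literature.AlgebraicGeometry.CossartPiltant200819.CP2008.TameSegmentClimb2008_holds
    (k : Type u) [Field k] :
    TameSegmentClimb2008 k :=
  _root_.Literature.AlgebraicGeometry.CossartPiltant200819.CP2008.tameSegmentClimb2008 k

/-- **The coarse tower exists** — unconditional.
[cite: CossartPiltant2008, Thm 7.2 proof (HAL pp. 20–21)] -/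
theorem coarseTowerExists2008 : CoarseTowerExists2008 k :=
  coarseTowerExists2008_of_layers TameLayersTotallyRamified2008_holds

/-- **The Galois tower exists** — unconditional.
[cite: CossartPiltant2008, Thm 7.2 proof (HAL pp. 20–21)] -/
theorem galoisTowerExists2008 : GaloisTowerExists2008 k :=
  galoisTowerExists2008_of_layers TameLayersTotallyRamified2008_holds

/-- **The tower of Thm 7.2 exists** — unconditional.
[cite: CossartPiltant2008, Thm 7.2 proof (HAL pp. 20–21)] -/
theorem towerExists2008 : TowerExists2008 k :=
  towerExists2008_of_tame (tameSegmentClimb2008 k)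

/-- **Theorem 7.2 from its three printed leaves**: Cor 6.3 (`ClimbToInertiaField`), Prop 8.3
(`PrimeDegreeAscent`) and Prop 9.5 (`DescentBelowRamificationField`) imply
`ReductionToArtinSchreier` — the tower bookkeeping of the proof of Thm 7.2 (HAL pp. 19–21) being
entirely kernel-checked. [cite: CossartPiltant2008, Thm 7.2 (HAL pp. 19–21)] -/
theorem reductionToArtinSchreier_of_leaves (h63 : ClimbToInertiaField.{u})
    (h83 : PrimeDegreeAscent.{u}) (h95 : DescentBelowRamificationField.{u}) :
    ReductionToArtinSchreier.{u} :=
  reductionToArtinSchreier_of_layers h63 h83 h95 TameLayersTotallyRamified2008_holds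

/-- **`LU3DiffFinite` from its leaves**: Prop 5.1, Cor 6.3, Prop 8.3, Prop 9.5 and [CP-II].
[cite: CossartPiltant2008, Thm 7.2 + Section 2] -/
theorem lu3DiffFinite_of_leaves (p51 : RankReduction.{u}) (h63 : ClimbToInertiaField.{u})
    (h83 : PrimeDegreeAscent.{u}) (h95 : DescentBelowRamificationField.{u})
    (cp2 : CossartPiltant2009Main.{u}) : LU3DiffFinite.{u} :=
  lu3DiffFinite_of_layers p51 h63 h83 h95 TameLayersTotallyRamified2008_holds cp2

end Literature.AlgebraicGeometry.CossartPiltant200819.CP2008
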